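import Literature.NumberTheory.EllipticCurves.BigRepModuleShiftedFixedPointsProofs
import Mathlib.LinearAlgebra.Quotient.Card
import Mathlib.Data.Fintype.EquivFin
import HarnessLib

/-!
# The shifted endomorphism `Φ ↦ F(Φ(· − c)) − Φ` of `C^∞(ℤ_p, A)` has FINITE COKERNEL for finite `A`
# and `c ≠ 0` (the coinvariant half of the counting at a finitely decomposed place, GV00 Prop. 2.4)

Topic `NumberTheory/EllipticCurves`; namespace `Literature.NumberTheory.EllipticCurves.BigRepModule`.
`Proofs`-style file: THEOREMS ONLY (no definition, no named fact, no instance, no `sorry`). Cell `bsd-stepL`,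
K2 support 20495 `JSWSigmaLocalCharIdeal`, module L5 (finitely decomposed places); seat `bsd-stepL-imc-p1` g13.
Sibling of `BigRepModuleShiftedFixedPointsProofs` (the invariant half).

For the co-induced module `X = C^∞(ℤ_p, A)` (`BigRepModule 𝒪 p A`), an `𝒪`-linear `F : A → A` and a
shift `c ≠ 0`, let `N = T − 1` with `(TΦ)(x) = F(Φ(x − c))` (the action of a group element of
Frobenius exponent `c` on the big representation, minus the identity). Then `X / N(X)` — the
coinvariants, i.e. `H¹(⟨φ⟩^, X)` for a procyclic group topologically generated by `φ` acting through `T` —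
is FINITE when `A` is finite: `X` is the increasing union of the finite `T`-stable level-`n` pieces
`X_n = Maps(ℤ/pⁿ, A)`, on each of which `#coker(N) = #ker(N) ≤ #A^{p^{v_p(c)}}` (a fixed point is
determined by its values on `0, …, p^{v_p(c)} − 1`, `eq_of_forall_apply_natCast_eq_of_fixed`), and a
quotient exhausted by pieces with uniformly bounded cokernels is finite (pigeonhole,
`Module.finite_quotient_range_of_exhaustion`).

* `Module.finite_quotient_range_of_exhaustion` — generic: an endomorphism `N` of a module exhausted by
  an increasing sequence of `N`-stable finite submodules with `#ker(N|X_n) ≤ B` has finite cokernel;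
* **`finite_quotient_range_shift_sub_id`** — the cokernel of `Φ ↦ F(Φ(· − c)) − Φ` on
  `BigRepModule 𝒪 p A` is finite (`A` finite, `c ≠ 0`).

References: [GreenbergVatsal2000] Prop. 2.4; [SkinnerUrban2014] §3.1.3 (the co-induced model);
[SerreLocalFields1979] XIII §1 (`H¹(Ẑ, A) = A/(φ − 1)A`).
-/

noncomputable section

open scoped Classical

namespace Literature.NumberTheory.EllipticCurves

/-- **A quotient exhausted by finite pieces with bounded cokernels is finite.** Let `N` be an
endomorphism of a module `X`, `L₀ ≤ L₁ ≤ ⋯` finite `N`-stable submodules exhausting `X`, and suppose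
`#{x ∈ L_n | N x = 0} ≤ B` for all `n`. Then `X / N(X)` is finite: on each `L_n`, `#(L_n / N L_n) =
#ker(N|L_n) ≤ B`, and `B + 1` classes of `X / N(X)` would have representatives in a common `L_n`, two of
them congruent modulo `N(L_n) ⊆ N(X)` (pigeonhole). [cite: SerreLocalFields1979, XIII §1 (H¹ of a procyclic group as coinvariants)] -/
theorem Module.finite_quotient_range_of_exhaustion {R X : Type*} [Ring R] [AddCommGroup X] [_root_.Module R X]
    (N : X →ₗ[R] X) (L : ℕ → Submodule R X) (hmono : Monotone L) (hex : ∀ x, ∃ n, x ∈ L n)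
    (hfin : ∀ n, Finite (L n)) (hN : ∀ n, ∀ x ∈ L n, N x ∈ L n) (B : ℕ)
    (hker : ∀ n, Nat.card {x : L n // N x = 0} ≤ B) :
    Finite (X ⧸ LinearMap.range N) := by
  by_contra hinf
  haveI : Infinite (X ⧸ LinearMap.range N) := not_finite_iff_infinite.mp hinf
  obtain ⟨s, hs⟩ := Infinite.exists_subset_card_eq (X ⧸ LinearMap.range N) (B + 1)
  -- representatives and a common level
  obtain ⟨lift, hlift⟩ : ∃ f : X ⧸ LinearMap.range N → X,
      ∀ q, Submodule.Quotient.mk (f q) = q :=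
    ⟨fun q => (Submodule.mkQ_surjective _ q).choose, fun q => (Submodule.mkQ_surjective _ q).choose_spec⟩
  choose lev hlev using hex
  set n := s.sup fun q => lev (lift q) with hn
  have hmem : ∀ q ∈ s, lift q ∈ L n := fun q hq =>
    hmono (Finset.le_sup (f := fun q => lev (lift q)) hq) (hlev (lift q))
  -- the restriction of `N` to `L n`
  haveI := hfin n
  set N' : L n →ₗ[R] L n := N.restrict (hN n) with hN'
  haveI : Finite (L n ⧸ LinearMap.range N') := Finite.of_surjective _ (Submodule.mkQ_surjective _)
  have hcardQ : Nat.card (L n ⧸ LinearMap.range N') ≤ B := by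
    have h1 := Submodule.card_eq_card_quotient_mul_card (LinearMap.range N')
    have h2 := Submodule.card_eq_card_quotient_mul_card (LinearMap.ker N')
    rw [Nat.card_congr N'.quotKerEquivRange.toEquiv] at h2
    have hr : Nat.card (LinearMap.range N') ≠ 0 := Nat.card_pos.ne'
    have h3 : Nat.card (L n ⧸ LinearMap.range N') = Nat.card (LinearMap.ker N') := by
      have h4 : Nat.card (LinearMap.range N') * Nat.card (L n ⧸ LinearMap.range N') =
          Nat.card (LinearMap.range N') * Nat.card (LinearMap.ker N') := by
        rw [← h1, h2, mul_comm]
      exact Nat.eq_of_mul_eq_mul_left (Nat.pos_of_ne_zero hr) h4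
    rw [h3]
    refine le_trans (le_of_eq (Nat.card_congr (Equiv.subtypeEquiv (Equiv.refl _) fun x => ?_))) (hker n)
    change N' x = 0 ↔ N (x : X) = 0
    rw [hN']
    exact ⟨fun h => congrArg Subtype.val h, fun h => Subtype.ext h⟩
  -- pigeonhole on `s → L n ⧸ N'(L n)`
  haveI := Fintype.ofFinite (L n ⧸ LinearMap.range N')
  let f : X ⧸ LinearMap.range N → L n ⧸ LinearMap.range N' := fun q =>
    if h : lift q ∈ L n then Submodule.Quotient.mk ⟨lift q, h⟩ else 0
  obtain ⟨q, hq, q', hq', hne, hqq'⟩ := Finset.exists_ne_map_eq_of_card_lt_of_maps_to (f := f)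
    (t := Finset.univ) (by
      rw [Finset.card_univ, ← Nat.card_eq_fintype_card, hs]
      exact Nat.lt_succ_of_le hcardQ) (fun q _ => Finset.mem_univ _)
  apply hne
  have hf : (Submodule.Quotient.mk ⟨lift q, hmem q hq⟩ : L n ⧸ LinearMap.range N') =
      Submodule.Quotient.mk ⟨lift q', hmem q' hq'⟩ := by
    have e := hqq'
    simp only [f, dif_pos (hmem q hq), dif_pos (hmem q' hq')] at e
    exact e
  rw [Submodule.Quotient.eq] at hf
  obtain ⟨y, hy⟩ := hf
  have hy' : N (y : X) = lift q - lift q' := by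
    have := congrArg Subtype.val hy
    simpa [hN'] using this
  rw [← hlift q, ← hlift q', Submodule.Quotient.eq]
  exact ⟨y, hy'⟩

namespace BigRepModule

variable {𝒪 : Type*} [CommRing 𝒪] {p : ℕ} [Fact p.Prime] {A : Type*} [AddCommGroup A] [Module 𝒪 A]

/-- **The shifted endomorphism minus the identity has finite cokernel** on `C^∞(ℤ_p, A)` for FINITE `A`
and `c ≠ 0`: with `N Φ = F ∘ Φ ∘ (· − c) − Φ` (`mapRange F ∘ translate (−c) − id`), the quotient
`BigRepModule 𝒪 p A ⧸ N(BigRepModule 𝒪 p A)` is finite — the level-`n` functions form finite `N`-stable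
pieces on which `#coker = #ker ≤ #A^{p^{v_p(c)}}` (`eq_of_forall_apply_natCast_eq_of_fixed`).
[cite: GreenbergVatsal2000, Prop. 2.4 (finitely decomposed primes)] [cite: SerreLocalFields1979, XIII §1] -/
theorem finite_quotient_range_shift_sub_id [Finite A] (F : A →ₗ[𝒪] A) {c : ℤ_[p]} (hc : c ≠ 0) :
    Finite (BigRepModule 𝒪 p A ⧸ LinearMap.range
      ((mapRange (p := p) F).comp (translate (-c)) - LinearMap.id)) := by
  set N : BigRepModule 𝒪 p A →ₗ[𝒪] BigRepModule 𝒪 p A :=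
    (mapRange (p := p) F).comp (translate (-c)) - LinearMap.id with hN
  have hNapply : ∀ (Φ : BigRepModule 𝒪 p A) (x : ℤ_[p]), N Φ x = F (Φ (x - c)) - Φ x := by
    intro Φ x
    change F (Φ (x + -c)) - Φ x = F (Φ (x - c)) - Φ x
    rw [← sub_eq_add_neg]
  -- the level-`n` pieces
  let L : ℕ → Submodule 𝒪 (BigRepModule 𝒪 p A) := fun n =>
    { carrier := {Φ | IsSmoothOfLevel p A n Φ}
      add_mem' := fun {Φ Ψ} hΦ hΨ x y hxy => by
        change (Φ + Ψ) x = (Φ + Ψ) y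
        rw [add_apply, add_apply, hΦ x y hxy, hΨ x y hxy]
      zero_mem' := fun _ _ _ => rfl
      smul_mem' := fun a Φ hΦ x y hxy => by
        change (a • Φ) x = (a • Φ) y
        rw [smul_apply, smul_apply, hΦ x y hxy] }
  have hLmem : ∀ n (Φ : BigRepModule 𝒪 p A), Φ ∈ L n ↔ IsSmoothOfLevel p A n Φ := fun _ _ => Iff.rfl
  have hmono : Monotone L := by
    intro n m hnm Φ hΦ x y hxy
    exact (hLmem n Φ).1 hΦ x y (Ideal.span_singleton_le_span_singleton.mpr (pow_dvd_pow _ hnm) hxy)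
  have hex : ∀ Φ : BigRepModule 𝒪 p A, ∃ n, Φ ∈ L n := fun Φ => Φ.exists_level
  -- level-`n` functions are determined by their values on `0, …, p^n − 1`
  have hfin : ∀ n, Finite (L n) := by
    intro n
    refine Finite.of_injective (fun Φ : L n => fun i : Fin (p ^ n) => (Φ : BigRepModule 𝒪 p A) (i : ℕ))
      fun Φ Ψ h => Subtype.ext (BigRepModule.ext fun y => ?_)
    have hy : y - (y.appr n : ℤ_[p]) ∈ Ideal.span {(p : ℤ_[p]) ^ n} := PadicInt.appr_spec n y
    rw [(hLmem n _).1 Φ.2 y _ hy, (hLmem n _).1 Ψ.2 y _ hy]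
    exact congrFun h ⟨y.appr n, PadicInt.appr_lt y n⟩
  -- `N` preserves the level
  have hNL : ∀ n, ∀ Φ ∈ L n, N Φ ∈ L n := by
    intro n Φ hΦ x y hxy
    rw [hNapply, hNapply, (hLmem n Φ).1 hΦ x y hxy,
      (hLmem n Φ).1 hΦ (x - c) (y - c) (by simpa using hxy)]
  -- on each piece the kernel injects into `Maps({0,…,p^v−1}, A)`
  have hker : ∀ n, Nat.card {Φ : L n // N (Φ : BigRepModule 𝒪 p A) = 0} ≤
      Nat.card (Fin (p ^ c.valuation) → A) := by
    intro n
    haveI := hfin n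
    refine Nat.card_le_card_of_injective
      (fun Φ => fun i : Fin (p ^ c.valuation) => ((Φ : L n) : BigRepModule 𝒪 p A) (i : ℕ)) ?_
    intro Φ Ψ h
    have hΦ : ∀ x, F (((Φ : L n) : BigRepModule 𝒪 p A) (x - c)) = ((Φ : L n) : BigRepModule 𝒪 p A) x :=
      fun x => sub_eq_zero.mp (by rw [← hNapply]; exact congrArg (fun Ψ : BigRepModule 𝒪 p A => Ψ x) Φ.2)
    have hΨ : ∀ x, F (((Ψ : L n) : BigRepModule 𝒪 p A) (x - c)) = ((Ψ : L n) : BigRepModule 𝒪 p A) x :=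
      fun x => sub_eq_zero.mp (by rw [← hNapply]; exact congrArg (fun Ψ : BigRepModule 𝒪 p A => Ψ x) Ψ.2)
    exact Subtype.ext (Subtype.ext (eq_of_forall_apply_natCast_eq_of_fixed F hc hΦ hΨ
      fun i hi => congrFun h ⟨i, hi⟩))
  exact Module.finite_quotient_range_of_exhaustion N L hmono hex hfin hNL _ hker

end BigRepModule

end Literature.NumberTheory.EllipticCurves

end
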